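import Summits.Ventures.QEC.Census.CertTwoBlockShift
import Summits.Ventures.QEC.Census.CertInfoSetOrbitSound
import Summits.Ventures.QEC.Census.CertInfoSetOrbitFast
import HarnessLib

/-!
# The two-block shift lane — soundness (qec-type-01 gen 5; companion of `Census/CertTwoBlockShift.lean`)

One side of a CSS certificate (`Hsyn`, `Hstab` commuting on `n` qubits, allow-list `found` with `foundOK`) and a `ShiftHalf` `h`.
HYPOTHESES = the kernel verdicts of an emitted row file: `h.structOK n Hsyn gens`, `autGensOK n Hsyn Hstab gens` (qec-type-12),
`h.zeroCaseOK n wmax allow`, and for every coset word `z ∈ h.zList n` the forced-top-row verdict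
`TopReaches (bzLeaf wmax allow) (h.lightRows n) (h.topRow z) (t − 1)` (qec-type-01's lane engine via `Plane.topReaches_of_seg[2]`).
`blocks_pigeonhole`: weight `≤ 2t+1` ⇒ `≤ t` support points in one block. `half_sound`: no non-trivial logical of weight `≤ wmax`
has `≤ t` support points in the light block. `shift_lower_sound`: two halves with complementary light blocks and `wmax ≤ 2t + 1`
give `wmax < |w|` for every non-trivial logical `w` — LITERALLY the `hlow` hypothesis of qec-type-10's
`DistCert.isCode_of_onesided_lower`; wrappers `DistCert.lowZ_of_shift` / `dZ_code_of_shift`. PROOF: pigeonhole; transport by the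
word of a light support point (qec-search-4 `orbit_transport`, qec-type-12 `wordEquiv_val`); decomposition over the kernel basis
(qec-search-7 `eq_ofBits_freeSupp`) split into light part / forced column / heavy coset word; the verdict. HONEST FRAMING: no
certificate is read, no distance asserted; LIMIT as in the companion file (no gain for `δ ≥ 4–5`; complements the cover / orbit
lanes). Tier KERNEL, axioms standard, no `native_decide`. [folklore]
-/

set_option autoImplicit false

namespace Summit.Ventures.QEC.Census

open Matrix Literature.InformationTheory.QuantumCodes List

/-! ## Word bookkeeping -/

/-- Splitting an XOR of images along a Bool predicate. -/
theorem xorList_map_filter (f : ℕ → ℕ) (p : ℕ → Bool) : ∀ l : List ℕ,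
    xorList (l.map f) = xorList ((l.filter p).map f) ^^^ xorList ((l.filter fun x => !p x).map f)
  | [] => by simp [xorList]
  | a :: l => by
    rw [List.map_cons, xorList, xorList_map_filter f p l, List.filter_cons, List.filter_cons]
    cases p a
    · simp only [Bool.false_eq_true, ↓reduceIte, Bool.not_false, List.map_cons, xorList]
      rw [← Nat.xor_assoc, Nat.xor_comm (f a), Nat.xor_assoc]
    · simp only [↓reduceIte, Bool.not_true, Bool.false_eq_true, List.map_cons, xorList, Nat.xor_assoc]

/-- The selection word of a sub-list of `rowPos G 0` is below `2^|G|`. -/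
theorem xorFst_lt_of_sublist_rowPos (G : List ℕ) {S : List (ℕ × ℕ)} (hS : S.Sublist (rowPos G 0)) :
    xorFst S < 2 ^ G.length := by
  obtain ⟨J, hJsub, rfl⟩ := Plane.exists_map_of_sublist_rowPos G hS
  rw [Plane.xorFst_map_pair]
  refine xorList_lt _ _ fun x hx => ?_
  obtain ⟨j, hj, rfl⟩ := List.mem_map.1 hx
  exact Nat.pow_lt_pow_right (by norm_num) (List.mem_range.1 (hJsub.subset hj))

section Sound

variable {n : ℕ} {Hsyn Hstab : List ℕ}

/-- **Transported support count** (the `countB` form of qec-search-4's `length_freeSupp_comp_symm`). -/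
theorem countB_suppIdx_comp_symm (σ : Fin n ≃ Fin n) (w : Fin n → ZMod 2) (p : ℕ → Bool) (f : ℕ → ℕ)
    (hf : ∀ q : Fin n, f q = ((σ q : Fin n) : ℕ)) :
    countB p (suppIdx n (w ∘ σ.symm)) = countB (fun x => p (f x)) (suppIdx n w) := by
  rw [countB_suppIdx, countB_suppIdx]
  have hset : (Finset.univ.filter fun i : Fin n => (w ∘ σ.symm) i ≠ 0 ∧ p i = true) =
      (Finset.univ.filter fun x : Fin n => w x ≠ 0 ∧ p (f x) = true).map σ.toEmbedding := by
    ext i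
    simp only [Finset.mem_filter, Finset.mem_univ, true_and, Finset.mem_map_equiv, Function.comp_apply]
    rw [hf (σ.symm i), Equiv.apply_symm_apply]
  rw [hset, Finset.card_map]

/-- The weight splits along a Bool predicate on the support. -/
theorem hammingNorm_eq_countB_add (w : Fin n → ZMod 2) (p : ℕ → Bool) :
    hammingNorm w = countB p (suppIdx n w) + countB (fun x => !p x) (suppIdx n w) := by
  have hlen : (suppIdx n w).length = hammingNorm w := by
    have := length_suppList n [] w; rwa [suppList, List.length_map] at this
  rw [← hlen, ← length_filter_eq_countB, ← length_filter_eq_countB]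
  exact List.length_eq_length_filter_add p

/-- **Pigeonhole over the two blocks**: a vector of weight `≤ 2t + 1` has `≤ t` support points inside the block `p` or
`≤ t` support points outside it (`|c ∩ B₁| ≤ ⌊wmax/2⌋ ∨ |c ∩ B₂| ≤ ⌊wmax/2⌋` for `wmax ≤ 2t + 1`). -/
theorem blocks_pigeonhole (w : Fin n → ZMod 2) (p : ℕ → Bool) {t : ℕ} (hwt : hammingNorm w ≤ 2 * t + 1) :
    countB p (suppIdx n w) ≤ t ∨ countB (fun x => !p x) (suppIdx n w) ≤ t := by
  have := hammingNorm_eq_countB_add w p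
  omega

/-- The support index list is an increasing sub-list of `[0, n)`. -/
theorem suppIdx_sublist_range (w : Fin n → ZMod 2) : (suppIdx n w).Sublist (List.range n) := by
  rw [suppIdx, ← List.map_coe_finRange_eq_range]
  exact (List.filter_sublist).map _

/-- **The core step of a half** (no transport): a non-trivial logical `v` of weight `≤ wmax` WITH `p₀` in its support and `≤ t`
support points in the light block contradicts the forced-top-row verdicts. -/
theorem half_core {found : List (ℕ × List ℕ)} (hfound : ∀ e ∈ found, xorRows Hstab e.2 = e.1) (h : ShiftHalf)
    (hpiv : pivotsOK n h.ic.piv h.ic.red = true) (hcomb : combOK Hsyn h.ic.red h.ic.comb = true)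
    (hp0free : h.ic.piv.elem h.p0 = false) (hp0n : h.p0 < n) (hp0L : h.inL h.p0 = true)
    {wmax t : ℕ}
    (htop : ∀ z ∈ h.zList n, TopReaches (bzLeaf wmax (found.map Prod.fst)) (h.lightRows n) (h.topRow z) (t - 1))
    (v : Fin n → ZMod 2) (hv : rowMatrix n Hsyn *ᵥ v = 0) (hv' : v ∉ rowSpace (rowMatrix n Hstab))
    (hwt : hammingNorm v ≤ wmax) (hlight : countB h.inL (suppIdx n v) ≤ t) (hp0 : v ⟨h.p0, hp0n⟩ ≠ 0) : False := by
  set sI := suppIdx n v with hsI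
  -- the three parts of the free support
  set P : ℕ → Bool := fun q => h.inL q && !(h.ic.piv.elem q) && !(q == h.p0) with hP
  set Q : ℕ → Bool := fun q => !(h.inL q) && !(h.ic.piv.elem q) with hQ
  set Scols := sI.filter P with hScols
  set Zcols := sI.filter Q with hZcols
  set z := xorList (Zcols.map (kerVec h.ic.piv h.ic.red)) with hz
  have hsub : sI.Sublist (List.range n) := suppIdx_sublist_range v
  have hnd : sI.Nodup := nodup_suppIdx n v
  -- the decomposition
  have hdec := eq_ofBits_freeSupp (Hsyn := Hsyn) hpiv hcomb hv
  set light := (freeSupp n h.ic.piv v).filter h.inL with hlightDef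
  have hfree : freeSupp n h.ic.piv v = sI.filter fun q => !(h.ic.piv.elem q) := rfl
  have hp0mem : h.p0 ∈ light := by
    rw [hlightDef, List.mem_filter, hfree, List.mem_filter]
    exact ⟨⟨(mem_suppIdx_iff n v ⟨h.p0, hp0n⟩).2 hp0, by simp only [hp0free, Bool.not_false]⟩, hp0L⟩
  have hlightP : light.filter (fun q => !(q == h.p0)) = Scols := by
    rw [hlightDef, hfree, List.filter_filter, List.filter_filter, hScols]
    exact List.filter_congr fun x _ => by
      simp only [hP]; cases h.inL x <;> cases h.ic.piv.elem x <;> cases (x == h.p0) <;> rfl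
  have hlight0 : light.filter (fun q => !!(q == h.p0)) = [h.p0] := by
    have : light.filter (fun q => !!(q == h.p0)) = light.filter (fun q => q == h.p0) :=
      List.filter_congr fun x _ => by cases (x == h.p0) <;> rfl
    have hndl : light.Nodup := (hnd.filter _).filter _
    rw [this, List.filter_beq, List.count_eq_one_of_mem hndl hp0mem, List.replicate_one]
  have hheavy : (freeSupp n h.ic.piv v).filter (fun q => !(h.inL q)) = Zcols := by
    rw [hfree, List.filter_filter, hZcols]
  have hX : xorList ((freeSupp n h.ic.piv v).map (kerVec h.ic.piv h.ic.red)) = xorList (Scols.map (kerVec h.ic.piv h.ic.red)) ^^^ ((kerVec h.ic.piv h.ic.red) h.p0 ^^^ z) := by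
    rw [xorList_map_filter (kerVec h.ic.piv h.ic.red) h.inL, ← hlightDef, hheavy, xorList_map_filter (kerVec h.ic.piv h.ic.red) (fun q => !(q == h.p0)) light,
      hlightP, hlight0, List.map_singleton, xorList, xorList, Nat.xor_zero, Nat.xor_assoc]
  -- the light selection is short
  have hSlen : Scols.length ≤ t - 1 := by
    have h1 : light.length = Scols.length + 1 := by
      rw [List.length_eq_length_filter_add (fun q => !(q == h.p0)), hlightP, hlight0, List.length_singleton]
    have h2 : light.length ≤ countB h.inL sI := by
      rw [← length_filter_eq_countB, hlightDef, hfree, List.filter_filter]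
      have : (sI.filter fun a => h.inL a && !(h.ic.piv.elem a)) = (sI.filter h.inL).filter fun q => !(h.ic.piv.elem q) := by
        rw [List.filter_filter]
        exact List.filter_congr fun x _ => by cases h.inL x <;> cases h.ic.piv.elem x <;> rfl
      rw [this]
      exact (List.filter_sublist).length_le
    have h3 : 1 ≤ light.length := List.length_pos_of_mem hp0mem
    omega
  -- the coset word is listed, the light selection is a sub-list of the light rows
  have hzmem : z ∈ h.zList n := by
    rw [hz, ShiftHalf.zList]
    exact xorList_mem_subXors ((hsub.filter Q).map (kerVec h.ic.piv h.ic.red))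
  have hSsub : (Scols.map (kerVec h.ic.piv h.ic.red)).Sublist (h.lightRows n) := by
    rw [ShiftHalf.lightRows, ShiftHalf.lightCols, hScols]
    exact (hsub.filter P).map (kerVec h.ic.piv h.ic.red)
  obtain ⟨S, hS, hSx, hSl, -, -⟩ := exists_rowPos_sublist (h.lightRows n) 0 (Scols.map (kerVec h.ic.piv h.ic.red)) hSsub
  have hleaf := htop z hzmem S hS (by rw [hSl, List.length_map]; exact hSlen)
  -- read the leaf
  have hu : (xorFst S ^^^ 2 ^ (h.lightRows n).length) ≠ 0 := by
    intro h0
    have hb := congrArg (fun x => Nat.testBit x (h.lightRows n).length) h0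
    simp only [Nat.testBit_xor, Nat.testBit_two_pow_self, Nat.zero_testBit,
      Nat.testBit_lt_two_pow (xorFst_lt_of_sublist_rowPos _ hS)] at hb
    simp at hb
  have hc : xorSnd S ^^^ h.topRow z = xorList ((freeSupp n h.ic.piv v).map (kerVec h.ic.piv h.ic.red)) := by
    rw [hX, hSx, ShiftHalf.topRow]
  rw [bzLeaf, hc] at hleaf
  simp only [Bool.or_eq_true, beq_iff_eq] at hleaf
  have hclt : xorList ((freeSupp n h.ic.piv v).map (kerVec h.ic.piv h.ic.red)) < 2 ^ n := by
    refine xorList_lt n _ fun x hx => ?_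
    obtain ⟨j, hj, rfl⟩ := List.mem_map.1 hx
    exact kerVec_lt_two_pow hpiv (lt_of_mem_freeSupp v hj)
  rcases hleaf with (h0 | hwt') | hmem
  · exact hu h0
  · have := lt_popc_of_wtGt n wmax _ hclt hwt'
    rw [← hammingNorm_ofBits, ← hdec] at this
    omega
  · apply hv'
    rw [hdec]
    obtain ⟨e, he, hex⟩ : ∃ e ∈ found, e.1 = xorList ((freeSupp n h.ic.piv v).map (kerVec h.ic.piv h.ic.red)) := by
      simpa [List.mem_map] using List.mem_of_elem_eq_true hmem
    rw [← hex, ← hfound e he]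
    exact ofBits_xorRows_mem_rowSpace n Hstab e.2

/-- **Soundness of one half**: no non-trivial logical of weight `≤ wmax` has `≤ t` support points in the light block. -/
theorem half_sound (hcomm : rowMatrix n Hsyn * (rowMatrix n Hstab)ᵀ = 0) {found : List (ℕ × List ℕ)}
    (hfound : foundOK Hstab found = true)
    {gens : List AutGen} (hgens : autGensOK n Hsyn Hstab gens = true)
    (h : ShiftHalf) (hst : h.structOK n Hsyn gens = true) {wmax t : ℕ}
    (hzero : h.zeroCaseOK n wmax (found.map Prod.fst) = true)
    (htop : ∀ z ∈ h.zList n, TopReaches (bzLeaf wmax (found.map Prod.fst)) (h.lightRows n) (h.topRow z) (t - 1))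
    (w : Fin n → ZMod 2) (hw : rowMatrix n Hsyn *ᵥ w = 0) (hw' : w ∉ rowSpace (rowMatrix n Hstab))
    (hwt : hammingNorm w ≤ wmax) (hlight : countB h.inL (suppIdx n w) ≤ t) : False := by
  -- unpack the checks
  simp only [foundOK, List.all_eq_true, beq_iff_eq] at hfound
  simp only [ShiftHalf.structOK, infoSetStructOK, Bool.and_eq_true, decide_eq_true_eq, beq_iff_eq, List.all_eq_true,
    List.mem_range, Bool.not_eq_true'] at hst
  obtain ⟨⟨⟨⟨⟨-, ⟨hpiv, hcomb⟩⟩, ⟨⟨hp0L, hp0free⟩, hp0n⟩⟩, hwlen⟩, hwords⟩, htab⟩ := hst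
  by_cases hzeroL : countB h.inL (suppIdx n w) = 0
  · -- (a) no support in the light block: `w` is a coset word
    have hdec := eq_ofBits_freeSupp (Hsyn := Hsyn) hpiv hcomb hw
    have hsub : (suppIdx n w).Sublist (List.range n) := suppIdx_sublist_range w
    have hnoL : ∀ x ∈ suppIdx n w, h.inL x = false := by
      intro x hx
      by_contra hxL
      rw [Bool.not_eq_false] at hxL
      have : 1 ≤ countB h.inL (suppIdx n w) := by
        rw [← length_filter_eq_countB]
        exact List.length_pos_of_mem (List.mem_filter.2 ⟨hx, hxL⟩)
      omega
    set Q : ℕ → Bool := fun q => !(h.inL q) && !(h.ic.piv.elem q) with hQ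
    have hfreeQ : freeSupp n h.ic.piv w = (suppIdx n w).filter Q := by
      rw [freeSupp]
      exact List.filter_congr fun x hx => by rw [hQ]; simp [hnoL x hx]
    have hzmem : xorList ((freeSupp n h.ic.piv w).map (kerVec h.ic.piv h.ic.red)) ∈ h.zList n := by
      rw [hfreeQ, ShiftHalf.zList]
      exact xorList_mem_subXors ((hsub.filter Q).map (kerVec h.ic.piv h.ic.red))
    simp only [ShiftHalf.zeroCaseOK, List.all_eq_true, Bool.or_eq_true, beq_iff_eq] at hzero
    have hclt : xorList ((freeSupp n h.ic.piv w).map (kerVec h.ic.piv h.ic.red)) < 2 ^ n := by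
      refine xorList_lt n _ fun x hx => ?_
      obtain ⟨j, hj, rfl⟩ := List.mem_map.1 hx
      exact kerVec_lt_two_pow hpiv (lt_of_mem_freeSupp w hj)
    rcases hzero _ hzmem with (h0 | hwt') | hmem
    · exact hw' (by rw [hdec, h0, ofBits_zero]; exact Submodule.zero_mem _)
    · have := lt_popc_of_wtGt n wmax _ hclt hwt'
      rw [← hammingNorm_ofBits, ← hdec] at this
      omega
    · apply hw'
      rw [hdec]
      obtain ⟨e, he, hex⟩ : ∃ e ∈ found, e.1 = xorList ((freeSupp n h.ic.piv w).map (kerVec h.ic.piv h.ic.red)) := by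
        simpa [List.mem_map] using List.mem_of_elem_eq_true hmem
      rw [← hex, ← hfound e he]
      exact ofBits_xorRows_mem_rowSpace n Hstab e.2
  · -- (b) a light support point `p`: transport it to `p₀`
    obtain ⟨p, hp, hpL⟩ : ∃ p ∈ suppIdx n w, h.inL p = true := by
      by_contra hne
      apply hzeroL
      rw [← length_filter_eq_countB, List.length_eq_zero_iff, List.filter_eq_nil_iff]
      intro a ha haL
      exact hne ⟨a, ha, haL⟩
    have hpn : p < n := lt_of_mem_suppIdx n w hp
    have hpL' := hpL
    simp only [ShiftHalf.inL, Bool.and_eq_true, decide_eq_true_eq] at hpL'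
    set i := p - h.lo with hi
    have hiw : i < h.hi - h.lo := by omega
    have hilen : i < h.words.length := by rw [hwlen]; exact hiw
    set wd := h.words.getD i [] with hwdDef
    have hwdmem : wd ∈ h.words := by
      rw [hwdDef, List.getD_eq_getElem?_getD, List.getElem?_eq_getElem hilen, Option.getD_some]
      exact List.getElem_mem hilen
    have hwd : ∀ g ∈ wd, g < gens.length := lt_of_autWordsOK hwords hwdmem
    have hwd' : ∀ g ∈ wd, g < (autPerms gens).length := by rw [List.length_map]; exact hwd
    set σ := wordEquiv n (autPerms gens) wd with hσ
    obtain ⟨hz1, hz2, hz3⟩ := orbit_transport hcomm hgens hwd w hw hw'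
    set v := w ∘ σ.symm with hvDef
    have hval : ∀ q : Fin n, permFun (wordPerm n (autPerms gens) wd) q = ((σ q : Fin n) : ℕ) :=
      wordEquiv_val (permListOK_of_autGensOK hgens) wd hwd'
    have hlop : h.lo + i = p := by omega
    have htab' := htab i hiw
    rw [← hwdDef, hlop] at htab'
    simp only [ShiftHalf.tabOK, Bool.and_eq_true, beq_iff_eq, List.all_eq_true, List.mem_range] at htab'
    obtain ⟨htabp, htabL⟩ := htab'
    -- `p₀ ∈ supp v`
    have hσp : σ ⟨p, hpn⟩ = ⟨h.p0, hp0n⟩ := Fin.ext (by rw [← hval ⟨p, hpn⟩]; exact htabp)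
    have hvp0 : v ⟨h.p0, hp0n⟩ ≠ 0 := by
      rw [hvDef, Function.comp_apply, ← hσp, Equiv.symm_apply_apply]
      exact (mem_suppIdx_iff n w ⟨p, hpn⟩).1 hp
    -- the light count is invariant
    have hcount : countB h.inL (suppIdx n v) = countB h.inL (suppIdx n w) := by
      rw [hvDef, countB_suppIdx_comp_symm σ w h.inL (permFun (wordPerm n (autPerms gens) wd)) hval]
      exact countB_congr _ _ _ fun x hx => (htabL x (lt_of_mem_suppIdx n w hx)).symm
    exact half_core hfound h hpiv hcomb hp0free hp0n hp0L htop v hz1 hz2 (hz3 ▸ hwt) (hcount ▸ hlight) hvp0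

/-- **SOUNDNESS OF THE TWO-BLOCK SHIFT LANE (one side).** See the file header. -/
theorem shift_lower_sound (hcomm : rowMatrix n Hsyn * (rowMatrix n Hstab)ᵀ = 0) {found : List (ℕ × List ℕ)}
    (hfound : foundOK Hstab found = true) (s : ShiftSide) {wmax : ℕ}
    (hgens : autGensOK n Hsyn Hstab s.gens = true) (hst : s.structOK n Hsyn wmax = true)
    (hzeroA : s.A.zeroCaseOK n wmax (found.map Prod.fst) = true)
    (hzeroB : s.B.zeroCaseOK n wmax (found.map Prod.fst) = true)
    (htopA : ∀ z ∈ s.A.zList n, TopReaches (bzLeaf wmax (found.map Prod.fst)) (s.A.lightRows n) (s.A.topRow z) (s.t - 1))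
    (htopB : ∀ z ∈ s.B.zList n, TopReaches (bzLeaf wmax (found.map Prod.fst)) (s.B.lightRows n) (s.B.topRow z) (s.t - 1))
    (w : Fin n → ZMod 2) (hw : rowMatrix n Hsyn *ᵥ w = 0) (hw' : w ∉ rowSpace (rowMatrix n Hstab)) :
    wmax < hammingNorm w := by
  by_contra hle
  rw [not_lt] at hle
  simp only [ShiftSide.structOK, Bool.and_eq_true, decide_eq_true_eq, List.all_eq_true, List.mem_range, beq_iff_eq]
    at hst
  obtain ⟨⟨⟨hA, hB⟩, hAB⟩, ht⟩ := hst
  have hBA : countB s.B.inL (suppIdx n w) = countB (fun x => !(s.A.inL x)) (suppIdx n w) :=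
    countB_congr _ _ _ fun x hx => hAB x (lt_of_mem_suppIdx n w hx)
  rcases blocks_pigeonhole w s.A.inL (le_trans hle ht) with hAle | hBle
  · exact half_sound hcomm hfound hgens s.A hA hzeroA htopA w hw hw' hle hAle
  · exact half_sound hcomm hfound hgens s.B hB hzeroB htopB w hw hw' hle (hBA ▸ hBle)

end Sound

/-! ## The certificate-level statements -/

namespace DistCert

variable (c : DistCert)

/-- **`Z`-side lower bound from the shift lane** (the `lowZ` hypothesis of `isCode_of_onesided_lower`). (theorem) -/
theorem lowZ_of_shift (hs : c.checkStructure = true) (s : ShiftSide)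
    (hgens : autGensOK c.n c.HX c.HZ s.gens = true) (hst : s.structOK c.n c.HX (c.dZ - 1) = true)
    (hzeroA : s.A.zeroCaseOK c.n (c.dZ - 1) (c.sideZ.found.map Prod.fst) = true)
    (hzeroB : s.B.zeroCaseOK c.n (c.dZ - 1) (c.sideZ.found.map Prod.fst) = true)
    (htopA : ∀ z ∈ s.A.zList c.n,
      TopReaches (bzLeaf (c.dZ - 1) (c.sideZ.found.map Prod.fst)) (s.A.lightRows c.n) (s.A.topRow z) (s.t - 1))
    (htopB : ∀ z ∈ s.B.zList c.n,
      TopReaches (bzLeaf (c.dZ - 1) (c.sideZ.found.map Prod.fst)) (s.B.lightRows c.n) (s.B.topRow z) (s.t - 1)) :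
    ∀ w : Fin c.n → ZMod 2, rowMatrix c.n c.HX *ᵥ w = 0 → w ∉ rowSpace (rowMatrix c.n c.HZ) →
      c.dZ - 1 < hammingNorm w := by
  have h' := hs
  simp only [checkStructure, Bool.and_eq_true] at h'
  exact shift_lower_sound (comm_of_commOK (c.commOK_of_checkStructure hs)) h'.1.1.2 s hgens hst hzeroA hzeroB htopA htopB

/-- **`d_Z` from the shift lane** (upper: the certificate's weight-`dZ` witness; lower: `lowZ_of_shift`). (theorem) -/
theorem dZ_code_of_shift (hs : c.checkStructure = true) (s : ShiftSide)
    (hgens : autGensOK c.n c.HX c.HZ s.gens = true) (hst : s.structOK c.n c.HX (c.dZ - 1) = true)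
    (hzeroA : s.A.zeroCaseOK c.n (c.dZ - 1) (c.sideZ.found.map Prod.fst) = true)
    (hzeroB : s.B.zeroCaseOK c.n (c.dZ - 1) (c.sideZ.found.map Prod.fst) = true)
    (htopA : ∀ z ∈ s.A.zList c.n,
      TopReaches (bzLeaf (c.dZ - 1) (c.sideZ.found.map Prod.fst)) (s.A.lightRows c.n) (s.A.topRow z) (s.t - 1))
    (htopB : ∀ z ∈ s.B.zList c.n,
      TopReaches (bzLeaf (c.dZ - 1) (c.sideZ.found.map Prod.fst)) (s.B.lightRows c.n) (s.B.topRow z) (s.t - 1))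
    (hd : 1 ≤ c.dZ) : (c.code (c.commOK_of_checkStructure hs)).dZ = c.dZ := by
  have h' := hs
  simp only [checkStructure, Bool.and_eq_true] at h'
  obtain ⟨hv, hv', hwt⟩ := upper_sound h'.1.1.1.2
  refine (c.code _).dZ_eq_of_witness hv hv' hwt fun w hw hw' => ?_
  have := c.lowZ_of_shift hs s hgens hst hzeroA hzeroB htopA htopB w hw hw'
  omega

end DistCert

end Summit.Ventures.QEC.Census
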